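import Summits.QuantumFields.BalabanUV.T4Continuum.Support.ShellMeasureExpHaarAreaSUN

/-!
# `T4Continuum.ShellMeasureExpHaarClosedBallSUN` — (CH)₁ FOR `SU(N)` ON THE FULL WINDOW RANGE `0 ≤ S ≤ π` that S3 f5
# types: the exponential chart is one-to-one, with invertible differential, on the CLOSED Hilbert–Schmidt ball of radius
# `π` (trace-free generators have all eigenvalue angles STRICTLY inside `(−π, π)` there)
# (cell `pub-balaban`, sub-cell `t4`, spine estimate NE7c (node U5b); ROUND-2 crew `t4-ne7c-formalise-*`; row S3 (c5: optional,
# last) — the end-point `S = π` left out by `ShellMeasureExpHaarAreaSUN.haar_restrict_expBallSU` (`S < π`); seat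
# `b2b-balaban-t4-ne7c-formalise-leaf-10` (gen 5); tree target `Summits/QuantumFields/BalabanUV/T4Continuum/Support/`;
# ADDITIVE — imports the assembly (AF) `ShellMeasureExpHaarAreaSUN` (hence (H), (RC), STEP 1, STEP 2, S3 f4–f6) only)

HONEST FRAMING.  Finite four-torus programme, rung (B)+1 only — NOT infinite volume, NOT a mass gap, NOT the Clay
problem, NOT summit progress.  Nothing of [Balaban 1983–89] is mentioned or asserted; classical Lie-group measure theory,
[folklore], 0 sorry, 0 citations, no `def … : Prop`, no data def.  A discharged (CH)₁ changes NOTHING in the countdown: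
S3 is the optional `SU(N)` road, NE7c's wall ((M1) at live levels ⇐ SM-L1/L4/L6 + U1b's rate) is untouched, NE7c NOT
proved (spine PROVED 0/9).
HONEST DEPENDENCY (cell, verbatim): continuum YM on T⁴ ⇐ BetaPertH ∧ nine spine estimates (0/9 proved); BetaPertH ⇐ (D1) ∧
(D4) ∧ CAP+tail; G-an2-4 gates asym, D1 and NE2/3/4.

THE POINTS.
* §1 `sum_eigen_eq_zero` (`Σ θ_k = 0`: the generator is trace-free) and **`abs_eigen_lt_pi`**: on the CLOSED ball
  `‖v‖_HS ≤ π` every eigenvalue angle satisfies `|θ_k| < π` STRICTLY (if `|θ_k| ≥ π ≥ ‖v‖` then `‖v‖² = Σ θ²` kills the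
  other angles and the trace condition kills `θ_k`); hence all gaps `|θ_j − θ_i| < 2π` (`abs_sub_eigen_lt_two_pi`).
* §2 `expPtSU_injOn_pi` — S3 f6's Lagrange-interpolation proof of `expPtSU_injOn`, VERBATIM with §1's bound: the chart is
  ONE-TO-ONE on `closedBall 0 π`; `det_duhT_pos_of_norm_le_pi` (STEP 2's `det_eq_prod_sinc` + `prod_sinc_sq_pos`) and
  `injective_fderiv_expM_le` (STEP 1's `injective_chartDeriv_of_injective`): the differential is injective for `‖v‖ ≤ π`.
* §3 the area formula and the assembly of (AF) re-run with `S ≤ π` (`map_expM_withDensity_jacM_le`,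
  `map_expPtSU_withDensity_jacM_le`), **`haar_restrict_expBallSU_le (hS : S ≤ π)`** = S3 f5's `hCH` TOKEN-FOR-TOKEN with
  `κ := kappaSU N`, and **`slotAntiConcentration_realized_suN_le (hS : 0 ≤ S) (hSπ : S ≤ π)`** = EXACTLY S3 f5's
  `slotAntiConcentration_realized_suN_expJac` minus its two located inputs `κ`, `hCH` — every other binder verbatim.

WHAT THIS DOES NOT DO.  Nothing at live levels of Bałaban's flow; NE7c NOT proved.
-/

noncomputable section

namespace Summit.QuantumFields.BalabanUV.T4Continuum.ShellMeasureExpHaarClosedBallSUN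

open MeasureTheory Measure Set Metric Function Filter Topology Matrix Finset
open scoped ENNReal NNReal Matrix.Norms.Frobenius
open Complex (I)
open Literature.MathematicalPhysics.QuantumFieldTheory.Balaban1983to89
open T4AdjointCovarianceUnitary (lieSU)
open ShellMeasureExpChartSUN ShellMeasureExpJacobianSUN ShellMeasureHaarHausdorffSUN ShellMeasureExpHaarAreaSUN
open ShellMeasureVandermondeSUN (conjDiag trace_conjDiag)
open ShellMeasureScalingSUN (expBallSU)
open ShellMeasureExpDuhamelSUN (genSUL duhT genSU_duhT_eq_integral injective_chartDeriv_of_injective)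
open ShellMeasureExpDuhamelDetSUN (det_eq_prod_sinc prod_sinc_sq_pos)
open ShellMeasureExpInjectiveSUN (aeval_exp_eq_genSU log_cexp_mul_I)

variable {N : ℕ}

/-! ## §1 On the CLOSED Hilbert–Schmidt ball of radius `π` every eigenvalue angle is STRICTLY inside `(−π, π)` -/

section Eigen

variable {v : ChartSU N} {U : Matrix.unitaryGroup (Fin N) ℂ} {θ : Fin N → ℝ}

/-- the eigenvalue angles of a chart point sum to zero (the generator is trace-free). [folklore] -/
theorem sum_eigen_eq_zero (h : herm v = conjDiag U fun k => (θ k : ℂ)) : ∑ k, θ k = 0 := by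
  have h1 : (herm v).trace = 0 := by
    rw [herm, trace_smul, trace_genSU, smul_zero]
  rw [h, trace_conjDiag, ← Complex.ofReal_sum] at h1
  exact_mod_cast h1

/-- **STRICT EIGENVALUE BOUND ON THE CLOSED `π`-BALL**: `‖v‖ ≤ π ⟹ |θ_k| < π` for every `k` — equality `|θ_k| = ‖v‖` would
force all other angles to vanish (`‖v‖² = Σ θ²`) and then `θ_k = −Σ_{j≠k} θ_j = 0`. [folklore] -/
theorem abs_eigen_lt_pi (h : herm v = conjDiag U fun k => (θ k : ℂ)) (hv : ‖v‖ ≤ Real.pi) (k : Fin N) :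
    |θ k| < Real.pi := by
  by_contra hk
  have hk' : Real.pi ≤ |θ k| := not_lt.mp hk
  have hsq := norm_sq_eq_sum_sq h
  have hsum := sum_eigen_eq_zero h
  rw [← Finset.add_sum_erase _ _ (mem_univ k)] at hsq hsum
  have hrest : ∑ j ∈ univ.erase k, θ j ^ 2 ≤ 0 := by
    have h1 : θ k ^ 2 = |θ k| ^ 2 := (sq_abs _).symm
    nlinarith [norm_nonneg v, Real.pi_pos, abs_nonneg (θ k)]
  have hzero : ∀ j ∈ univ.erase k, θ j = 0 := fun j hj => by
    have := (Finset.sum_eq_zero_iff_of_nonneg (fun i _ => sq_nonneg (θ i))).mp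
      (le_antisymm hrest (Finset.sum_nonneg fun i _ => sq_nonneg (θ i))) j hj
    exact pow_eq_zero_iff two_ne_zero |>.mp this
  have hk0 : θ k = 0 := by
    rw [Finset.sum_eq_zero hzero, add_zero] at hsum
    exact hsum
  rw [hk0, abs_zero] at hk'
  linarith [Real.pi_pos]

/-- all eigenvalue GAPS are `< 2π` on the closed `π`-ball. [folklore] -/
theorem abs_sub_eigen_lt_two_pi (h : herm v = conjDiag U fun k => (θ k : ℂ)) (hv : ‖v‖ ≤ Real.pi) (i j : Fin N) :
    |θ j - θ i| < 2 * Real.pi :=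
  (abs_sub _ _).trans_lt (by linarith [abs_eigen_lt_pi h hv j, abs_eigen_lt_pi h hv i])

end Eigen

/-! ## §2 Injectivity of the chart and of its derivative on the CLOSED `π`-ball -/

section Closed

/-- **THE EXPONENTIAL CHART IS ONE-TO-ONE ON THE CLOSED BALL `‖v‖ ≤ π`** (S3 f6's Lagrange-interpolation argument
`ShellMeasureExpInjectiveSUN.expPtSU_injOn`, fed with the strict bound of §1). [folklore] -/
theorem expPtSU_injOn_pi : InjOn (expPtSU (N := N)) (Metric.closedBall 0 Real.pi) := by
  intro v hv w hw hvw
  rw [Metric.mem_closedBall, dist_zero_right] at hv hw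
  obtain ⟨U, θ, hθ⟩ := exists_conjDiag v
  obtain ⟨V, φ, hφ⟩ := exists_conjDiag w
  have hθπ : ∀ k, |θ k| < Real.pi := abs_eigen_lt_pi hθ hv
  have hφπ : ∀ k, |φ k| < Real.pi := abs_eigen_lt_pi hφ hw
  have hg : NormedSpace.exp (genSU v) = NormedSpace.exp (genSU w) := by
    rw [← coe_expPtSU, ← coe_expPtSU, hvw]
  classical
  let s : Finset ℂ := (univ.image fun k => Complex.exp (θ k * I)) ∪ univ.image fun k => Complex.exp (φ k * I)
  let p : Polynomial ℂ := Lagrange.interpolate s id Complex.log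
  have hp : ∀ z ∈ s, p.eval z = Complex.log z := fun z hz =>
    Lagrange.eval_interpolate_at_node (r := Complex.log) (v := id) (Set.injOn_id _) hz
  have hpθ : ∀ k, p.eval (Complex.exp (θ k * I)) = (θ k : ℂ) * I := fun k => by
    rw [hp _ (mem_union_left _ (mem_image_of_mem _ (mem_univ k))), log_cexp_mul_I (hθπ k)]
  have hpφ : ∀ k, p.eval (Complex.exp (φ k * I)) = (φ k : ℂ) * I := fun k => by
    rw [hp _ (mem_union_right _ (mem_image_of_mem _ (mem_univ k))), log_cexp_mul_I (hφπ k)]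
  have hgen : genSU v = genSU w := by
    rw [← aeval_exp_eq_genSU hθ hpθ, ← aeval_exp_eq_genSU hφ hpφ, hg]
  have hc : (coordSU v : lieSU (Fin N)) = coordSU w := Subtype.ext hgen
  exact (coordSU (N := N)).injective hc

/-- `expM` is one-to-one on the closed ball of radius `S ≤ π`. [folklore] -/
theorem injOn_expM_le {S : ℝ} (hS : S ≤ Real.pi) : InjOn (expM (N := N)) (closedBall 0 S) :=
  fun _ hv _ hw hvw => expPtSU_injOn_pi (closedBall_subset_closedBall hS hv) (closedBall_subset_closedBall hS hw)
    (Subtype.ext hvw)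

/-- **`0 < det T_v` ON THE CLOSED `π`-BALL** (STEP 2's `det_eq_prod_sinc` + `prod_sinc_sq_pos` with the gaps of §1).
[folklore] -/
theorem det_duhT_pos_of_norm_le_pi {v : ChartSU N} (hv : ‖v‖ ≤ Real.pi) :
    0 < LinearMap.det (duhT v : ChartSU N →ₗ[ℝ] ChartSU N) := by
  obtain ⟨U, θ, h⟩ := exists_conjDiag v
  rw [det_eq_prod_sinc h _ (genSU_duhT_eq_integral v)]
  exact prod_sinc_sq_pos (abs_sub_eigen_lt_two_pi h hv)

/-- **THE DERIVATIVE OF THE AMBIENT CHART IS INJECTIVE FOR `‖v‖ ≤ π`.** [folklore] -/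
theorem injective_fderiv_expM_le {v : ChartSU N} (hv : ‖v‖ ≤ Real.pi) : Injective (fderiv ℝ (expM (N := N)) v) := by
  rw [fderiv_expM]
  exact injective_chartDeriv_of_injective
    (LinearMap.equivOfDetNeZero _ (det_duhT_pos_of_norm_le_pi hv).ne').injective

/-! ## §3 The area formula and (CH)₁ on the closed window `S ≤ π` -/

/-- the area formula for the chart on `B̄_S`, `S ≤ π`. [folklore] -/
theorem map_expM_withDensity_jacM_le {S : ℝ} (hS : S ≤ Real.pi) :
    Measure.map (expM (N := N)) (((volume : Measure (ChartSU N)).restrict (closedBall 0 S)).withDensity jacM) =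
      (μHE[dimSU N] : Measure (MatC N)).restrict (expM '' closedBall (0 : ChartSU N) S) := by
  letI : InnerProductSpace ℝ (MatC N) := hsInnerProductSpace
  have h := Literature.Analysis.Calculus.map_withDensity_normDet_eq_euclideanHausdorffMeasure
    (s := closedBall (0 : ChartSU N) S) (f := expM (N := N)) (f' := fun v => fderiv ℝ (expM (N := N)) v)
    measurableSet_closedBall (fun v _ => (hasFDerivAt_expM v).hasFDerivWithinAt.congr_fderiv (fderiv_expM v).symm)
    (fun v hv => injective_fderiv_expM_le ((mem_closedBall_zero_iff.mp hv).trans hS)) (injOn_expM_le hS)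
    continuous_expM.measurable
  rw [finrank_euclideanSpace_fin] at h
  exact h

/-- the area formula on the group for `S ≤ π`. [folklore] -/
theorem map_expPtSU_withDensity_jacM_le {S : ℝ} (hS : S ≤ Real.pi) :
    Measure.map (expPtSU (N := N)) (((volume : Measure (ChartSU N)).restrict (closedBall 0 S)).withDensity jacM) =
      (hausdorffSU N).restrict (expBallSU S) := by
  have hval := measurableEmbedding_val (N := N)
  ext t ht
  have hpre : expPtSU ⁻¹' t = expM (N := N) ⁻¹' (Subtype.val '' t) := by
    rw [show expM (N := N) = Subtype.val ∘ expPtSU from rfl, preimage_comp,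
      preimage_image_eq _ Subtype.val_injective]
  rw [Measure.map_apply measurable_expPtSU ht, hpre,
    ← Measure.map_apply continuous_expM.measurable (hval.measurableSet_image.mpr ht), map_expM_withDensity_jacM_le hS,
    Measure.restrict_apply (hval.measurableSet_image.mpr ht), Measure.restrict_apply ht, image_expM,
    ← image_inter Subtype.val_injective, hausdorff_image_val]
  rfl

variable [NeZero N]

/-- **(CH)₁ FOR `SU(N)` ON THE CLOSED WINDOW**: for every `N ≥ 1` and every `S ≤ π`,
`Haar_{SU(N)} ⌞ expBallSU S = expPtSU_* (vol ⌞ B̄_S · expJacWeightSU κ_N)` — S3 f5's binder `hCH` TOKEN-FOR-TOKEN with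
`κ := kappaSU N`, over the FULL radius range `0 ≤ S ≤ π` that S3 f5 types. [folklore] -/
theorem haar_restrict_expBallSU_le {S : ℝ} (hS : S ≤ Real.pi) :
    (HaarData.haar : Measure (SUN N)).restrict (expBallSU S) =
      (((volume : Measure (ChartSU N)).restrict (closedBall 0 S)).withDensity (expJacWeightSU (kappaSU N))).map
        expPtSU := by
  have hsmul : (fun v => kappaSU N * jacM (N := N) v) = kappaSU N • jacM := rfl
  have h1 : (HaarData.haar : Measure (SUN N)).restrict (expBallSU S) =
      Measure.map expPtSU (((volume : Measure (ChartSU N)).restrict (closedBall 0 S)).withDensity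
        fun v => kappaSU N * jacM v) := by
    rw [hsmul, withDensity_smul _ measurable_jacM, Measure.map_smul, map_expPtSU_withDensity_jacM_le hS,
      haar_eq_smul_hausdorffSU, Measure.restrict_smul]
    rfl
  rw [h1]
  congr 1
  refine withDensity_congr_ae ?_
  filter_upwards [ae_restrict_of_ae (jacM_ae_eq_expJacSU (N := N))] with v hv
  rw [hv, expJacWeightSU]

/-- **THE `SU(N)` REALIZED (M1) ENGINE WITH (CH)₁ SUPPLIED, FULL WINDOW RANGE `0 ≤ S ≤ π`**: EXACTLY S3 f5's
`ShellMeasureRealizedSUN.slotAntiConcentration_realized_suN_expJac` minus its two located inputs `κ`, `hCH`. [folklore] -/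
theorem slotAntiConcentration_realized_suN_le {P : Params} {j : ℕ} [DecidableEq (PBond P j)]
    (Λ : Finset (PBond P j)) {S : ℝ} (hS : 0 ≤ S) (hSπ : S ≤ Real.pi)
    (c : GaugeField P j (SUN N) → GaugeField P j (SUN N))
    {R : GaugeField P j (SUN N) → (↥Λ → SUN N) → ℝ≥0∞} (hR : ∀ V, Measurable (R V))
    {F : GaugeField P j (SUN N) → ℝ≥0∞} (hF : Measurable F)
    (hFw : ∀ V y, F (updateFinset V Λ y) = ShellMeasureScalingSUN.windowSU Λ (c V) S y * R V y)
    (hfin : ∀ V, ((T4ShellMeasureDet.blockLaw Λ).withDensity fun y => F (updateFinset V Λ y)) univ ≠ ∞)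
    {u : GaugeField P j (SUN N) → ℝ} (hu : Measurable u) {θ ρ a Bf D : ℝ} (hθ : 0 ≤ θ) (hρ : 0 ≤ ρ) (ha : 0 ≤ a)
    (haD : ((Λ.card * dimSU N : ℕ) + Bf) * a ≤ D * ρ)
    (hcore : ∀ V x, x ∈ closedBall (0 : BlockChartSU N Λ) S → R V (expFibreChartSU Λ (c V) x) ≠ 0 →
      u (updateFinset V Λ (expFibreChartSU Λ (c V) x)) < θ →
      u (updateFinset V Λ (expFibreChartSU Λ (c V) (Real.exp (-a) • x))) < θ * (1 - ρ))
    (hden : ∀ V x, x ∈ closedBall (0 : BlockChartSU N Λ) S → R V (expFibreChartSU Λ (c V) x) ≠ 0 →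
      u (updateFinset V Λ (expFibreChartSU Λ (c V) x)) < θ →
      R V (expFibreChartSU Λ (c V) x) ≤
        ENNReal.ofReal (Real.exp (Bf * a)) * R V (expFibreChartSU Λ (c V) (Real.exp (-a) • x))) :
    T4ShellMeasure.SlotAntiConcentration ((fieldMeasure P j (SUN N)).withDensity F) u θ ρ D :=
  ShellMeasureRealizedSUN.slotAntiConcentration_realized_suN_expJac Λ hS hSπ (kappaSU N)
    (haar_restrict_expBallSU_le hSπ) c hR hF hFw hfin hu hθ hρ ha haD hcore hden

end Closed

end Summit.QuantumFields.BalabanUV.T4Continuum.ShellMeasureExpHaarClosedBallSUN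

end
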